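import Summits.Ventures.PercRepro.SixThreeTableA

/-!
# PercRepro — the (6,3) additive one-long-line table, part B: from the Boolean table to the inequalities (p3, gen 7 / gen 9 split)

Continues `SixThreeTableA.lean` (the profile function `Δ_t = A_t(g) + Σ_ℓ B_t(g, m_ℓ)` of mine-2's `MINE2-RLS.md` §19.7
Steps 3–4 at θ = 6 and its kernel-checked table `tableOK_of : tableOK t g = true` for `t ∈ {1,2,3}`, `4 ≤ g ≤ 40`): the
bridge from the Boolean `tableOK` to the five inequalities of record — `table_general_short` (all lines short,
`Σ C(m,2) ≤ C(g,2)`), `table_general_long` (one long line), `table_linePoint`, `table_twoLines_meet`,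
`table_twoLines_disj` — through `ρ_mul_le_B` (the minimum `ρ_t(g)` of `B/C(m,2)` over the short lines).  The statements
are those of the gen-7 file (`SixThreeStep5*.lean` and p2's seam use them unchanged).
-/

namespace PercRepro.SixThree.Table

/-! ## From the Boolean table to the inequalities (the bridge) -/

/-- `foldl min` starting at `a` is `≤ a` and `≤` every element. -/
theorem foldl_min_le (l : List ℚ) (a : ℚ) :
    l.foldl min a ≤ a ∧ ∀ x ∈ l, l.foldl min a ≤ x := by
  induction l generalizing a with
  | nil => simp
  | cons y l ih =>
    obtain ⟨h1, h2⟩ := ih (min a y)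
    refine ⟨le_trans h1 (min_le_left _ _), ?_⟩
    intro x hx
    rcases List.mem_cons.1 hx with rfl | hx
    · exact le_trans h1 (min_le_right _ _)
    · exact h2 x hx

/-- `ρ_t(g) ≤ 0`. -/
theorem ρ_nonpos (t g : ℕ) : ρ t g ≤ 0 := by
  unfold ρ; exact (foldl_min_le _ _).1

/-- `ρ_t(g)·C(m,2) ≤ B_t(g,m)` for every short line `3 ≤ m ≤ ⌊(g+1)/2⌋`. -/
theorem ρ_mul_le_B {t g m : ℕ} (hm3 : 3 ≤ m) (hmh : m ≤ (g + 1) / 2) :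
    ρ t g * (ch m 2 : ℚ) ≤ B t g m := by
  have hmem : m ∈ (List.range ((g + 1) / 2 + 1)).filter fun m => decide (3 ≤ m) := by
    rw [List.mem_filter, List.mem_range]; exact ⟨by omega, by simpa using hm3⟩
  have hle : ρ t g ≤ B t g m / (ch m 2 : ℚ) := by
    unfold ρ
    exact (foldl_min_le _ 0).2 _ (List.mem_map_of_mem hmem)
  have hpos : (0 : ℚ) < (ch m 2 : ℚ) := by
    rw [ch_eq_choose]; exact_mod_cast Nat.choose_pos (by omega)
  calc ρ t g * (ch m 2 : ℚ) ≤ B t g m / (ch m 2 : ℚ) * (ch m 2 : ℚ) :=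
        mul_le_mul_of_nonneg_right hle hpos.le
    _ = B t g m := div_mul_cancel₀ _ hpos.ne'

/-- the general-plane part of `tableOK`. -/
theorem generalOK_of {t g : ℕ} (h : tableOK t g = true) :
    0 ≤ A t g + (ch g 2 : ℚ) * ρ t g ∧
      ∀ m, (g + 1) / 2 < m → m + 3 ≤ g → 0 ≤ A t g + B t g m + ((ch g 2 : ℚ) - ch m 2) * ρ t g := by
  unfold tableOK generalOK at h
  simp only [Bool.and_eq_true, List.all_eq_true, decide_eq_true_eq] at h
  obtain ⟨⟨⟨h0, h1⟩, -⟩, -⟩ := h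
  refine ⟨h0, fun m hm1 hm2 => ?_⟩
  have := h1 m (List.mem_range.2 (by omega))
  simpa [hm1, hm2] using this

/-- the line + point part of `tableOK`: `0 ≤ A + B(g−1) − 3[t = 2]`. -/
theorem linePointOK_of {t g : ℕ} (h : tableOK t g = true) :
    0 ≤ A t g + B t g (g - 1) - (if t = 2 then 3 else 0) := by
  unfold tableOK linePointOK at h
  simp only [Bool.and_eq_true, decide_eq_true_eq] at h
  exact h.1.2

/-- the two-lines part of `tableOK`: meeting (`m₁ + m₂ = g + 1`, `3 ≤ m₂ ≤ m₁`) and disjoint (`m₁ + m₂ = g`, `2 ≤ m₂ ≤ m₁`). -/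
theorem twoLinesOK_of {t g : ℕ} (h : tableOK t g = true) :
    (∀ m₁ m₂, 3 ≤ m₂ → m₂ ≤ m₁ → m₁ + m₂ = g + 1 →
        0 ≤ A t g + B t g m₁ + B t g m₂ - (if t = 3 then 12 else 0)) ∧
    (∀ m₁ m₂, 2 ≤ m₂ → m₂ ≤ m₁ → m₁ + m₂ = g →
        0 ≤ A t g + B t g m₁ + (if 3 ≤ m₂ then B t g m₂ else 0) - (if t = 3 then 6 else 0)) := by
  unfold tableOK twoLinesOK at h
  simp only [Bool.and_eq_true, List.all_eq_true] at h
  obtain ⟨-, h2⟩ := h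
  constructor
  · intro m₁ m₂ h3 hle hsum
    have := (h2 m₁ (List.mem_range.2 (by omega)) m₂ (List.mem_range.2 (by omega))).1
    simpa [h3, hsum] using this
  · intro m₁ m₂ h2' hle hsum
    have := (h2 m₁ (List.mem_range.2 (by omega)) m₂ (List.mem_range.2 (by omega))).2
    simpa [h2', hsum] using this

/-! ## The profile statements of §19.7 Step 4 -/

/-- Sum over a list of short lines: `ρ·Σ C(m,2) ≤ Σ B(m)`. -/
theorem ρ_mul_sum_le {t g : ℕ} (prof : List ℕ) (hshort : ∀ m ∈ prof, 3 ≤ m ∧ m ≤ (g + 1) / 2) :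
    ρ t g * (prof.map fun m => (ch m 2 : ℚ)).sum ≤ (prof.map (B t g)).sum := by
  induction prof with
  | nil => simp
  | cons m l ih =>
    have hm := hshort m List.mem_cons_self
    have hl := ih fun x hx => hshort x (List.mem_cons_of_mem _ hx)
    simp only [List.map_cons, List.sum_cons, mul_add]
    exact add_le_add (ρ_mul_le_B hm.1 hm.2) hl

/-- **General plane, no long line** (`every line ≤ ⌊(g+1)/2⌋`, `Σ C(m,2) ≤ C(g,2)`): `0 ≤ A_t(g) + Σ_ℓ B_t(g, m_ℓ)`. -/
theorem table_general_short {t g : ℕ} (ht : t = 1 ∨ t = 2 ∨ t = 3) (hg4 : 4 ≤ g) (hg40 : g ≤ 40)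
    (prof : List ℕ) (hshort : ∀ m ∈ prof, 3 ≤ m ∧ m ≤ (g + 1) / 2)
    (hsum : (prof.map fun m => (ch m 2 : ℚ)).sum ≤ ch g 2) :
    0 ≤ A t g + (prof.map (B t g)).sum := by
  have h0 := (generalOK_of (tableOK_of ht hg4 hg40)).1
  have h1 := ρ_mul_sum_le (t := t) (g := g) prof hshort
  have h2 : (ch g 2 : ℚ) * ρ t g ≤ ρ t g * (prof.map fun m => (ch m 2 : ℚ)).sum := by
    rw [mul_comm]; exact mul_le_mul_of_nonpos_left hsum (ρ_nonpos t g)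
  linarith

/-- **General plane with one long line** `m₀` (`⌊(g+1)/2⌋ < m₀ ≤ g − 3`, the other lines short,
`C(m₀,2) + Σ C(m,2) ≤ C(g,2)`): `0 ≤ A_t(g) + B_t(g, m₀) + Σ_ℓ B_t(g, m_ℓ)`. -/
theorem table_general_long {t g : ℕ} (ht : t = 1 ∨ t = 2 ∨ t = 3) (hg4 : 4 ≤ g) (hg40 : g ≤ 40)
    (m₀ : ℕ) (hm₀ : (g + 1) / 2 < m₀) (hm₀' : m₀ + 3 ≤ g)
    (prof : List ℕ) (hshort : ∀ m ∈ prof, 3 ≤ m ∧ m ≤ (g + 1) / 2)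
    (hsum : (ch m₀ 2 : ℚ) + (prof.map fun m => (ch m 2 : ℚ)).sum ≤ ch g 2) :
    0 ≤ A t g + B t g m₀ + (prof.map (B t g)).sum := by
  have h0 := (generalOK_of (tableOK_of ht hg4 hg40)).2 m₀ hm₀ hm₀'
  have h1 := ρ_mul_sum_le (t := t) (g := g) prof hshort
  have h2 : ((ch g 2 : ℚ) - ch m₀ 2) * ρ t g ≤ ρ t g * (prof.map fun m => (ch m 2 : ℚ)).sum := by
    rw [mul_comm]; exact mul_le_mul_of_nonpos_left (by linarith) (ρ_nonpos t g)
  linarith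

/-- **Line + point** (`m = g − 1`): `0 ≤ A_t(g) + B_t(g, g−1) − 3[t = 2]`. -/
theorem table_linePoint {t g : ℕ} (ht : t = 1 ∨ t = 2 ∨ t = 3) (hg4 : 4 ≤ g) (hg40 : g ≤ 40) :
    0 ≤ A t g + B t g (g - 1) - (if t = 2 then 3 else 0) :=
  linePointOK_of (tableOK_of ht hg4 hg40)

/-- **Two lines meeting in a point** (`g = m₁ + m₂ − 1`, `3 ≤ m₂ ≤ m₁`): `0 ≤ A + B(m₁) + B(m₂) − 12[t = 3]`. -/
theorem table_twoLines_meet {t g : ℕ} (ht : t = 1 ∨ t = 2 ∨ t = 3) (hg4 : 4 ≤ g) (hg40 : g ≤ 40)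
    {m₁ m₂ : ℕ} (h3 : 3 ≤ m₂) (hle : m₂ ≤ m₁) (hsum : m₁ + m₂ = g + 1) :
    0 ≤ A t g + B t g m₁ + B t g m₂ - (if t = 3 then 12 else 0) :=
  (twoLinesOK_of (tableOK_of ht hg4 hg40)).1 m₁ m₂ h3 hle hsum

/-- **Two disjoint lines** (`g = m₁ + m₂`, `2 ≤ m₂ ≤ m₁`, a 2-point line contributes `0`): `0 ≤ A + B(m₁) + B(m₂) − 6[t = 3]`. -/
theorem table_twoLines_disj {t g : ℕ} (ht : t = 1 ∨ t = 2 ∨ t = 3) (hg4 : 4 ≤ g) (hg40 : g ≤ 40)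
    {m₁ m₂ : ℕ} (h2 : 2 ≤ m₂) (hle : m₂ ≤ m₁) (hsum : m₁ + m₂ = g) :
    0 ≤ A t g + B t g m₁ + (if 3 ≤ m₂ then B t g m₂ else 0) - (if t = 3 then 6 else 0) :=
  (twoLinesOK_of (tableOK_of ht hg4 hg40)).2 m₁ m₂ h2 hle hsum

end PercRepro.SixThree.Table

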